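import Summits.Schanuel.Schanuel.Theorems.ZilberEacRelationGeneral
import Summits.Schanuel.Schanuel.Theorems.ZilberEacComplexGraphEscapeLemmas
import Summits.Schanuel.Schanuel.Theorems.ZilberEacPunctureDensityPoly
import Mathlib.Topology.Algebra.Polynomial
import Mathlib.Algebra.MvPolynomial.Funext
import HarnessLib

/-!
# THEOREM K (explosion dominance): Zariski density from solutions accumulating
# super-polynomially fast at a Zariski-dense family of parallel lines, with an exponentially
# LARGE power coordinate

Zilber's Exponential-Algebraic Closedness, case ladder (host summit Schanuel, cell `pub-schanuel`,
seat 2, gen 10).  THEOREMS J / J′ (`ZilberEacDirectionalDominance{,Puncture}`) gave density for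
`(s+2)`-folds from solutions along lattice RAYS with a power coordinate of irrational polynomial
growth (J) or super-polynomial decay (J′).  In the EXPLOSION regime of a graph hypersurface base
(`Re g_D(2πiq) > 0` for every lattice direction, e.g. `x₂ = -(x₀² + x₁²)`) the solutions of the
exp–exp balance do not follow rays: they accumulate super-polynomially fast at a family of
PARALLEL COMPLEX LINES of the base, and the power coordinate `w = e^{g(x)}` is exponentially LARGE
along them.  This file is the matching elimination engine:

* `eventually_eval_cons_ne_zero_of_explosion` (THEOREM K₀) — `H ∈ ℂ[W, X₀..X_t]`,
  `H = Σ_c G_c(X) W^c`, top coefficient `G_C`; points `x_m` with `‖x_m - ℓ(z_m)‖ ≤ ‖z_m‖^{-N}`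
  for every `N` (`ℓ` an affine line, `‖z_m‖ → ∞`), `‖w_m‖ ≥ ‖z_m‖^{N}` for every `N`, and
  `|G_C(ℓ(z_m))| ≥ γ > 0`: then `H(w_m, x_m) ≠ 0` for large `m` (the top power of `W` dominates;
  `H ≠ 0` is implied by `γ > 0`);
* `exists_generic_lineRestrict` — for `G ≠ 0` and slopes `λ`, off a proper Zariski closed set of
  offsets `ν` the restriction of `G` to the line `z ↦ (z, λ z + ν)` is a nonzero polynomial
  (shear automorphism + `finSuccEquiv`);
* `exists_int_eval_translate_ne_zero` — translated lattices `κ + aℤ^t` are Zariski dense;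
* THEOREM K `unprojectedDense_polyFibredGraph_of_nearLine` — for `W = polyFibredGraph g A F`
  (`x_{s+1} = g(x)`, `yⱼ = Aⱼ(x) + y_{s+1}Fⱼ(y_{s+1}, x)`): if for every offset `ν` of a
  Zariski-dense set there are solutions `x⁽ⁱ⁾` of `e^{xⱼ} = Aⱼ(x) + e^{g(x)}Fⱼ(e^{g(x)}, x)`
  super-polynomially close to the line `z ↦ (z, λz + ν)` (`‖z_i‖ → ∞`) with
  `Re g(x⁽ⁱ⁾) ≥ N log ‖z_i‖` for every `N`, then `I(W ∩ Γ_exp) = I(W)` (THEOREM H⁽ᵏ⁾,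
  `unprojectedDense_of_no_relation`, with the coordinates `(y_{s+1}; x₀, …, x_s)`).

The existence of such solutions in the explosion regime is `ZilberEacExplosionExistence`
(2-variable exp–exp balance).  HONEST FRAMING: elimination lemma for explicit families inside the
OPEN cell `EC(3,2)`; NOT Schanuel's conjecture; EAC ⇏ SC.
-/

noncomputable section

open Complex MvPolynomial Filter Topology Finset
open Literature.NumberTheory.Transcendental Literature.ModelTheory.Zilber
  Literature.ModelTheory.ExponentialFields

set_option linter.dupNamespace false

namespace Summit.Schanuel.Schanuel.Theorems

/-! ## Part A. Univariate lower bound and the `W`-expansion -/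

section Expansion

variable {t : ℕ}

/-- A nonzero univariate polynomial is eventually bounded below by a positive constant along any
sequence tending to infinity. [folklore] -/
theorem exists_eventually_norm_eval_ge (q : Polynomial ℂ) (hq : q ≠ 0) {z : ℕ → ℂ}
    (hz : Tendsto (fun m => ‖z m‖) atTop atTop) :
    ∃ γ : ℝ, 0 < γ ∧ ∀ᶠ m in atTop, γ ≤ ‖q.eval (z m)‖ := by
  by_cases hdeg : 0 < q.degree
  · exact ⟨1, one_pos, (q.tendsto_norm_atTop hdeg hz).eventually_ge_atTop 1⟩
  · have hq' : q = Polynomial.C (q.coeff 0) :=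
      Polynomial.eq_C_of_degree_le_zero (le_of_not_gt hdeg)
    have hc : q.coeff 0 ≠ 0 := by
      intro h; apply hq; rw [hq', h, map_zero]
    refine ⟨‖q.coeff 0‖, norm_pos_iff.2 hc, Eventually.of_forall fun m => ?_⟩
    have : q.eval (z m) = q.coeff 0 := by
      rw [hq']; simp only [Polynomial.eval_C, Polynomial.coeff_C_zero]
    rw [this]

/-- `H(w, x) = Σ_{c ≤ deg_W P} (P.coeff c)(x) · w^c` with `P = finSuccEquiv H ∈ ℂ[X][W]`.
[folklore] -/
theorem eval_cons_eq_sum_range (H : MvPolynomial (Fin (t + 1)) ℂ) (w : ℂ) (x : Fin t → ℂ) :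
    eval (Fin.cons w x : Fin (t + 1) → ℂ) H =
      ∑ c ∈ range ((finSuccEquiv ℂ t H).natDegree + 1),
        eval x ((finSuccEquiv ℂ t H).coeff c) * w ^ c := by
  rw [eval_eq_eval_mv_eval', Polynomial.eval_eq_sum_range'
    (Polynomial.natDegree_map_le.trans_lt (Nat.lt_succ_self _))]
  refine Finset.sum_congr rfl fun c _ => ?_
  rw [Polynomial.coeff_map]

/-- Uniform polynomial growth of all the `W`-coefficients of `P ∈ ℂ[X][W]`. [folklore] -/
theorem exists_uniform_coeff_bound (P : Polynomial (MvPolynomial (Fin t) ℂ)) :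
    ∃ B : ℝ, 0 ≤ B ∧ ∃ N : ℕ, ∀ c, ∀ y : Fin t → ℂ,
      ‖eval y (P.coeff c)‖ ≤ B * (1 + ‖y‖) ^ N := by
  classical
  choose B hB0 N hN using fun c : ℕ =>
    HypersurfaceCover.exists_norm_eval_le_pow (r := t) (P.coeff c)
  refine ⟨∑ c ∈ range (P.natDegree + 1), B c, Finset.sum_nonneg fun c _ => hB0 c,
    ∑ c ∈ range (P.natDegree + 1), N c, fun c y => ?_⟩
  by_cases hc : c ≤ P.natDegree
  · have hcm : c ∈ range (P.natDegree + 1) := Finset.mem_range.2 (Nat.lt_succ_of_le hc)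
    have hy : 1 ≤ 1 + ‖y‖ := le_add_of_nonneg_right (norm_nonneg _)
    calc ‖eval y (P.coeff c)‖ ≤ B c * (1 + ‖y‖) ^ N c := hN c y
      _ ≤ (∑ c ∈ range (P.natDegree + 1), B c) *
            (1 + ‖y‖) ^ (∑ c ∈ range (P.natDegree + 1), N c) :=
          mul_le_mul (Finset.single_le_sum (fun c _ => hB0 c) hcm)
            (pow_le_pow_right₀ hy (Finset.single_le_sum (fun c _ => Nat.zero_le (N c)) hcm))
            (by positivity) (Finset.sum_nonneg fun c _ => hB0 c)
  · rw [Polynomial.coeff_eq_zero_of_natDegree_lt (lt_of_not_ge hc), map_zero, norm_zero]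
    exact mul_nonneg (Finset.sum_nonneg fun c _ => hB0 c) (by positivity)

/-- **THEOREM K₀ (explosion dominance).**  See the module docstring. (new)
[cite: MantovaMasser2023, §1 p.5 (the open case dim π(V) = 2 in ℂ³×ℂˣ³)] -/
theorem eventually_eval_cons_ne_zero_of_explosion (H : MvPolynomial (Fin (t + 1)) ℂ)
    (ℓ : ℂ → Fin t → ℂ) {z : ℕ → ℂ} {x : ℕ → Fin t → ℂ} {w : ℕ → ℂ}
    (hz : Tendsto (fun m => ‖z m‖) atTop atTop)
    (hℓ : ∃ C₀ : ℝ, ∀ᶠ m in atTop, ‖ℓ (z m)‖ ≤ C₀ * ‖z m‖)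
    (htop : ∃ γ : ℝ, 0 < γ ∧
      ∀ᶠ m in atTop, γ ≤ ‖eval (ℓ (z m)) (finSuccEquiv ℂ t H).leadingCoeff‖)
    (hx : ∀ N : ℕ, ∀ᶠ m in atTop, ‖z m‖ ^ N * ‖x m - ℓ (z m)‖ ≤ 1)
    (hw : ∀ N : ℕ, ∀ᶠ m in atTop, ‖z m‖ ^ N ≤ ‖w m‖) :
    ∀ᶠ m in atTop, eval (Fin.cons (w m) (x m) : Fin (t + 1) → ℂ) H ≠ 0 := by
  classical
  set P := finSuccEquiv ℂ t H with hP
  set C := P.natDegree with hC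
  obtain ⟨B, hB0, N, hBN⟩ := exists_uniform_coeff_bound P
  obtain ⟨K, hK0, M, hKM⟩ := exists_norm_eval_add_sub_eval_le (P.coeff C)
  obtain ⟨C₀, hC₀⟩ := hℓ
  obtain ⟨γ, hγ, hγm⟩ := htop
  set C₁ : ℝ := |C₀| + 1 with hC₁
  have hC₁pos : 0 < C₁ := by positivity
  set K₂ : ℝ := K * 2 ^ M * (1 + C₁) ^ M with hK₂
  have hK₂0 : 0 ≤ K₂ := by positivity
  set K₃ : ℝ := C * B * (C₁ + 2) ^ N with hK₃
  have hK₃0 : 0 ≤ K₃ := by positivity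
  filter_upwards [hz.eventually_ge_atTop (max 1 (max (2 * K₂ / γ + 1) (2 * K₃ / γ + 1))), hC₀, hγm,
    hx 0, hx (M + 1), hw 0, hw (N + 1)] with m hzm hℓm hγm' hx0 hxM hw0 hwN
  have hz1 : 1 ≤ ‖z m‖ := le_of_max_le_left hzm
  have hzK₂ : 2 * K₂ / γ + 1 ≤ ‖z m‖ := le_of_max_le_left (le_of_max_le_right hzm)
  have hzK₃ : 2 * K₃ / γ + 1 ≤ ‖z m‖ := le_of_max_le_right (le_of_max_le_right hzm)
  have hz0 : 0 < ‖z m‖ := by linarith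
  rw [pow_zero, one_mul] at hx0
  rw [pow_zero] at hw0
  -- geometry
  have hℓ1 : ‖ℓ (z m)‖ ≤ C₁ * ‖z m‖ := by
    refine hℓm.trans ?_
    rw [hC₁]
    nlinarith [le_abs_self C₀, norm_nonneg (z m)]
  have hxn : ‖x m‖ ≤ (C₁ + 1) * ‖z m‖ := by
    have : ‖x m‖ ≤ ‖ℓ (z m)‖ + ‖x m - ℓ (z m)‖ := by
      calc ‖x m‖ = ‖ℓ (z m) + (x m - ℓ (z m))‖ := by rw [add_sub_cancel]
        _ ≤ ‖ℓ (z m)‖ + ‖x m - ℓ (z m)‖ := norm_add_le _ _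
    nlinarith
  -- the top coefficient at `x m`
  have htopx : γ / 2 ≤ ‖eval (x m) (P.coeff C)‖ := by
    have hlead : P.leadingCoeff = P.coeff C := rfl
    have hinc := hKM (ℓ (z m)) (x m - ℓ (z m))
    rw [add_sub_cancel] at hinc
    have h1 : (1 + ‖ℓ (z m)‖) ^ M ≤ ((1 + C₁) * ‖z m‖) ^ M := by
      refine pow_le_pow_left₀ (by positivity) ?_ _
      nlinarith
    have h2 : (1 + ‖x m - ℓ (z m)‖) ^ M ≤ 2 ^ M :=
      pow_le_pow_left₀ (by positivity) (by linarith) _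
    have h3 : ‖eval (x m) (P.coeff C) - eval (ℓ (z m)) (P.coeff C)‖ ≤
        K₂ * (‖z m‖ ^ M * ‖x m - ℓ (z m)‖) := by
      refine hinc.trans ?_
      calc K * ‖x m - ℓ (z m)‖ * (1 + ‖ℓ (z m)‖) ^ M * (1 + ‖x m - ℓ (z m)‖) ^ M
          ≤ K * ‖x m - ℓ (z m)‖ * ((1 + C₁) * ‖z m‖) ^ M * 2 ^ M := by
            gcongr
        _ = K₂ * (‖z m‖ ^ M * ‖x m - ℓ (z m)‖) := by rw [hK₂, mul_pow]; ring
    have h4 : ‖z m‖ ^ M * ‖x m - ℓ (z m)‖ ≤ 1 / ‖z m‖ := by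
      rw [le_div_iff₀ hz0]
      calc ‖z m‖ ^ M * ‖x m - ℓ (z m)‖ * ‖z m‖ = ‖z m‖ ^ (M + 1) * ‖x m - ℓ (z m)‖ := by
            rw [pow_succ]; ring
        _ ≤ 1 := hxM
    have h5 : K₂ * (‖z m‖ ^ M * ‖x m - ℓ (z m)‖) ≤ γ / 2 := by
      refine (mul_le_mul_of_nonneg_left h4 hK₂0).trans ?_
      rw [mul_one_div, div_le_iff₀ hz0]
      have : 2 * K₂ / γ * γ = 2 * K₂ := by field_simp
      nlinarith [this, hγ]
    have h6 := norm_sub_norm_le (eval (ℓ (z m)) (P.coeff C)) (eval (x m) (P.coeff C))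
    rw [norm_sub_rev] at h3
    rw [hlead] at hγm'
    linarith
  -- the expansion and the lower-order terms
  rw [eval_cons_eq_sum_range, ← hP, ← hC, Finset.sum_range_succ]
  have hrest : ‖∑ c ∈ range C, eval (x m) (P.coeff c) * w m ^ c‖ ≤
      K₃ * ‖z m‖ ^ N * ‖w m‖ ^ (C - 1) := by
    have hxb : (1 + ‖x m‖) ^ N ≤ ((C₁ + 2) * ‖z m‖) ^ N := by
      refine pow_le_pow_left₀ (by positivity) ?_ _
      nlinarith
    calc ‖∑ c ∈ range C, eval (x m) (P.coeff c) * w m ^ c‖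
        ≤ ∑ c ∈ range C, ‖eval (x m) (P.coeff c) * w m ^ c‖ := norm_sum_le _ _
      _ ≤ ∑ c ∈ range C, B * ((C₁ + 2) * ‖z m‖) ^ N * ‖w m‖ ^ (C - 1) := by
          refine Finset.sum_le_sum fun c hc => ?_
          rw [norm_mul, norm_pow]
          have hcC : c ≤ C - 1 := by have := Finset.mem_range.1 hc; omega
          exact mul_le_mul ((hBN c (x m)).trans (mul_le_mul_of_nonneg_left hxb hB0))
            (pow_le_pow_right₀ hw0 hcC) (by positivity) (by positivity)
      _ = K₃ * ‖z m‖ ^ N * ‖w m‖ ^ (C - 1) := by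
          rw [Finset.sum_const, Finset.card_range, nsmul_eq_mul, hK₃, mul_pow]; ring
  have htopterm : γ / 2 * ‖w m‖ ^ C ≤ ‖eval (x m) (P.coeff C) * w m ^ C‖ := by
    rw [norm_mul, norm_pow]
    exact mul_le_mul_of_nonneg_right htopx (by positivity)
  -- dominance
  have hdom : K₃ * ‖z m‖ ^ N * ‖w m‖ ^ (C - 1) < γ / 2 * ‖w m‖ ^ C := by
    rcases Nat.eq_zero_or_pos C with hC0 | hCpos
    · have hK₃z : K₃ = 0 := by rw [hK₃, hC0]; simp
      rw [hK₃z, zero_mul, zero_mul, hC0, pow_zero, mul_one]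
      linarith
    · have hwC : ‖w m‖ ^ C = ‖w m‖ ^ (C - 1) * ‖w m‖ := by
        rw [← pow_succ]; congr 1; omega
      rw [hwC]
      have hw1 : 0 < ‖w m‖ ^ (C - 1) := pow_pos (by linarith) _
      have hkey : K₃ * ‖z m‖ ^ N < γ / 2 * ‖w m‖ := by
        have h1 : K₃ * ‖z m‖ ^ N < γ / 2 * ‖z m‖ ^ (N + 1) := by
          rw [pow_succ, show γ / 2 * (‖z m‖ ^ N * ‖z m‖) = (γ / 2 * ‖z m‖) * ‖z m‖ ^ N by ring]
          refine mul_lt_mul_of_pos_right ?_ (pow_pos hz0 _)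
          have h2 : γ / 2 * (2 * K₃ / γ + 1) ≤ γ / 2 * ‖z m‖ :=
            mul_le_mul_of_nonneg_left hzK₃ (by positivity)
          have h3 : γ / 2 * (2 * K₃ / γ + 1) = K₃ + γ / 2 := by
            field_simp
          linarith
        exact h1.trans_le (mul_le_mul_of_nonneg_left hwN (by positivity))
      nlinarith
  intro hsum
  have h1 := norm_add_le (-(∑ c ∈ range C, eval (x m) (P.coeff c) * w m ^ c))
    (∑ c ∈ range C, eval (x m) (P.coeff c) * w m ^ c + eval (x m) (P.coeff C) * w m ^ C)
  rw [neg_add_cancel_left, norm_neg, hsum, norm_zero, add_zero] at h1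
  linarith

end Expansion

/-! ## Part B. Generic members of a family of parallel lines; translated lattices -/

section Lines

variable {t : ℕ}

/-- Evaluating a substitution: `(bind₁ θ G)(x) = G(θ₀(x), …, θ_t(x))`. [folklore] -/
theorem eval_bind₁_eq (θ : Fin (t + 1) → MvPolynomial (Fin (t + 1)) ℂ)
    (G : MvPolynomial (Fin (t + 1)) ℂ) (x : Fin (t + 1) → ℂ) :
    eval x (bind₁ θ G) = eval (fun i => eval x (θ i)) G := by
  change eval₂Hom (RingHom.id ℂ) x (bind₁ θ G) = _
  rw [eval₂Hom_bind₁]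
  rfl

/-- **Generic members of a family of parallel lines.**  For `G ≠ 0` in `ℂ[X₀, …, X_t]` and
slopes `λ ∈ ℂ^t` there is a nonzero `R ∈ ℂ[Y₁, …, Y_t]` such that for every offset `ν` with
`R(ν) ≠ 0` the restriction of `G` to the line `z ↦ (z, λ₁ z + ν₁, …, λ_t z + ν_t)` is a NONZERO
univariate polynomial (shear automorphism `X_{j+1} ↦ λ_j X₀ + X_{j+1}` and `finSuccEquiv`).
[folklore] -/
theorem exists_generic_lineRestrict (G : MvPolynomial (Fin (t + 1)) ℂ) (hG : G ≠ 0)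
    (lam : Fin t → ℂ) :
    ∃ R : MvPolynomial (Fin t) ℂ, R ≠ 0 ∧ ∀ ν : Fin t → ℂ, eval ν R ≠ 0 →
      ∃ q : Polynomial ℂ, q ≠ 0 ∧
        ∀ z : ℂ, q.eval z = eval (Fin.cons z (fun j => lam j * z + ν j) : Fin (t + 1) → ℂ) G := by
  classical
  set θ : Fin (t + 1) → MvPolynomial (Fin (t + 1)) ℂ :=
    Fin.cons (X 0) (fun j => C (lam j) * X 0 + X j.succ) with hθ
  set θ' : Fin (t + 1) → MvPolynomial (Fin (t + 1)) ℂ :=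
    Fin.cons (X 0) (fun j => X j.succ - C (lam j) * X 0) with hθ'
  set Q : MvPolynomial (Fin (t + 1)) ℂ := bind₁ θ G with hQ
  have hinv : bind₁ θ' Q = G := by
    rw [hQ, bind₁_bind₁]
    have hX : (fun i => bind₁ θ' (θ i)) = X := by
      funext i
      refine Fin.cases ?_ (fun j => ?_) i
      · simp only [hθ, hθ', Fin.cons_zero, bind₁_X_right]
      · simp only [hθ, hθ', Fin.cons_succ, map_add, map_mul, bind₁_C_right, bind₁_X_right,
          Fin.cons_zero]
        ring
    rw [hX, bind₁_X_left, AlgHom.id_apply]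
  have hQ0 : Q ≠ 0 := fun h => hG (by rw [← hinv, h, map_zero])
  set P := finSuccEquiv ℂ t Q with hP
  have hP0 : P ≠ 0 := by
    rw [hP]; exact (EmbeddingLike.map_ne_zero_iff).2 hQ0
  obtain ⟨c, hc⟩ : ∃ c, P.coeff c ≠ 0 := by
    by_contra h
    push Not at h
    exact hP0 (Polynomial.ext fun c => by rw [h c, Polynomial.coeff_zero])
  refine ⟨P.coeff c, hc, fun ν hν => ⟨P.map (eval ν), ?_, fun z => ?_⟩⟩
  · intro h0
    apply hν
    have h1 := congrArg (fun p => Polynomial.coeff p c) h0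
    simpa only [Polynomial.coeff_map, Polynomial.coeff_zero] using h1
  · rw [← eval_eq_eval_mv_eval', hQ, eval_bind₁_eq]
    have hfun : (fun i => eval (Fin.cons z ν : Fin (t + 1) → ℂ) (θ i)) =
        (Fin.cons z (fun j => lam j * z + ν j) : Fin (t + 1) → ℂ) := by
      funext i
      refine Fin.cases ?_ (fun j => ?_) i
      · simp only [hθ, Fin.cons_zero, eval_X]
      · simp only [hθ, Fin.cons_succ, map_add, map_mul, eval_C, eval_X, Fin.cons_zero]
    rw [hfun]

/-- **Translated lattices are Zariski dense**: for `G ≠ 0`, any `κ ∈ ℂ^t` and `a ≠ 0` some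
`q ∈ ℤ^t` has `G(κ + a q) ≠ 0`. [folklore] -/
theorem exists_int_eval_translate_ne_zero {G : MvPolynomial (Fin t) ℂ} (hG : G ≠ 0)
    (κ : Fin t → ℂ) {a : ℂ} (ha : a ≠ 0) :
    ∃ q : Fin t → ℤ, eval (fun i => κ i + a * (q i : ℂ)) G ≠ 0 := by
  by_contra hcon
  push Not at hcon
  apply hG
  refine MvPolynomial.funext_set (fun i : Fin t => Set.range (fun q : ℤ => κ i + a * (q : ℂ)))
    (fun i => Set.infinite_range_of_injective fun q q' h => ?_) fun y hy => ?_
  · have h1 : a * (q : ℂ) = a * (q' : ℂ) := add_left_cancel h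
    exact_mod_cast mul_left_cancel₀ ha h1
  · rw [map_zero]
    have hy' : ∀ i, ∃ q : ℤ, κ i + a * (q : ℂ) = y i := fun i => hy i (Set.mem_univ i)
    choose q hq using hy'
    have hyq : y = fun i => κ i + a * (q i : ℂ) := funext fun i => (hq i).symm
    rw [hyq]
    exact hcon q

end Lines

/-! ## Part C. THEOREM K: density for `polyFibredGraph` from near-line solution families -/

section Density

variable {s : ℕ}

/-- Norm of a point of the line `z ↦ (z, λz + ν)`: `≤ (1 + ‖λ‖ + ‖ν‖)‖z‖` for `‖z‖ ≥ 1`.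
[folklore] -/
theorem norm_cons_line_le (lam ν : Fin s → ℂ) {z : ℂ} (hz : 1 ≤ ‖z‖) :
    ‖(Fin.cons z (fun j => lam j * z + ν j) : Fin (s + 1) → ℂ)‖ ≤ (1 + ‖lam‖ + ‖ν‖) * ‖z‖ := by
  refine (pi_norm_le_iff_of_nonneg (by positivity)).2 fun k => ?_
  refine Fin.cases ?_ (fun j => ?_) k
  · rw [Fin.cons_zero]
    nlinarith [norm_nonneg lam, norm_nonneg ν, norm_nonneg z]
  · rw [Fin.cons_succ]
    calc ‖lam j * z + ν j‖ ≤ ‖lam j‖ * ‖z‖ + ‖ν j‖ := by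
          refine (norm_add_le _ _).trans ?_; rw [norm_mul]
      _ ≤ ‖lam‖ * ‖z‖ + ‖ν‖ * ‖z‖ := by
          have h1 := norm_le_pi_norm lam j
          have h2 := norm_le_pi_norm ν j
          nlinarith [norm_nonneg z, norm_nonneg (ν j)]
      _ ≤ (1 + ‖lam‖ + ‖ν‖) * ‖z‖ := by nlinarith [norm_nonneg z]

/-- **THEOREM K (density from near-line solution families with exploding power coordinate).**
See the module docstring. (new)
[cite: MantovaMasser2023, §1 p.5 (the open case dim π(V) = 2 in ℂ³×ℂˣ³)] -/
theorem unprojectedDense_polyFibredGraph_of_nearLine (g : MvPolynomial (Fin (s + 1)) ℂ)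
    (A : Fin (s + 1) → MvPolynomial (Fin (s + 1)) ℂ)
    (F : Fin (s + 1) → MvPolynomial (Fin (s + 2)) ℂ) (lam : Fin s → ℂ) (M : Set (Fin s → ℂ))
    (hM : ∀ R : MvPolynomial (Fin s) ℂ, R ≠ 0 → ∃ ν ∈ M, eval ν R ≠ 0)
    (hsol : ∀ ν ∈ M, ∃ (z : ℕ → ℂ) (x : ℕ → Fin (s + 1) → ℂ),
      Tendsto (fun i => ‖z i‖) atTop atTop ∧
      (∀ᶠ i in atTop, ∀ j, exp (x i j) = eval (x i) (A j) +
        exp (eval (x i) g) * eval (Fin.cons (exp (eval (x i) g)) (x i) : Fin (s + 2) → ℂ) (F j)) ∧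
      (∀ N : ℕ, ∀ᶠ i in atTop,
        ‖z i‖ ^ N * ‖x i - Fin.cons (z i) (fun j => lam j * z i + ν j)‖ ≤ 1) ∧
      (∀ N : ℕ, ∀ᶠ i in atTop, ‖z i‖ ^ N ≤ Real.exp (eval (x i) g).re)) :
    UnprojectedDense (polyFibredGraph g A F) := by
  classical
  refine unprojectedDense_of_no_relation (k := s + 1) (isIrreducibleClosed_polyFibredGraph g A F)
    (by rw [zariskiDim_polyFibredGraph])
    (Fin.cons (Sum.inr (Fin.last (s + 1))) (fun j => Sum.inl (Fin.castSucc j)))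
    fun H hH => ?_
  have hlc : (finSuccEquiv ℂ (s + 1) H).leadingCoeff ≠ 0 :=
    Polynomial.leadingCoeff_ne_zero.2 ((EmbeddingLike.map_ne_zero_iff).2 hH)
  obtain ⟨R, hR0, hR⟩ := exists_generic_lineRestrict _ hlc lam
  obtain ⟨ν, hνM, hν⟩ := hM R hR0
  obtain ⟨q, hq0, hq⟩ := hR ν hν
  obtain ⟨z, x, hz, hsolx, hx, hw⟩ := hsol ν hνM
  set ℓ : ℂ → Fin (s + 1) → ℂ := fun ζ => Fin.cons ζ (fun j => lam j * ζ + ν j) with hℓ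
  have hℓb : ∃ C₀ : ℝ, ∀ᶠ i in atTop, ‖ℓ (z i)‖ ≤ C₀ * ‖z i‖ :=
    ⟨1 + ‖lam‖ + ‖ν‖, (hz.eventually_ge_atTop 1).mono fun i hi => norm_cons_line_le lam ν hi⟩
  have htop : ∃ γ : ℝ, 0 < γ ∧
      ∀ᶠ i in atTop, γ ≤ ‖eval (ℓ (z i)) (finSuccEquiv ℂ (s + 1) H).leadingCoeff‖ := by
    obtain ⟨γ, hγ, h⟩ := exists_eventually_norm_eval_ge q hq0 hz
    exact ⟨γ, hγ, h.mono fun i hi => by rwa [hq (z i)] at hi⟩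
  have hw' : ∀ N : ℕ, ∀ᶠ i in atTop, ‖z i‖ ^ N ≤ ‖exp (eval (x i) g)‖ := fun N =>
    (hw N).mono fun i hi => by rwa [Complex.norm_exp]
  have hev := eventually_eval_cons_ne_zero_of_explosion H ℓ hz hℓb htop hx hw'
  obtain ⟨i, hi, hisol⟩ := (hev.and hsolx).exists
  refine ⟨pgParam g A F (x i) (exp (eval (x i) g)),
    ⟨pgParam_mem g A F _ _, pgParam_mem_expGraph_of_solution g A F hisol⟩, ?_⟩
  have hcoord : (fun k => pgParam g A F (x i) (exp (eval (x i) g))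
      ((Fin.cons (Sum.inr (Fin.last (s + 1))) (fun j => Sum.inl (Fin.castSucc j)) :
        Fin (s + 2) → Fin (s + 2) ⊕ Fin (s + 2)) k)) =
      (Fin.cons (exp (eval (x i) g)) (x i) : Fin (s + 2) → ℂ) := by
    funext k
    refine Fin.cases ?_ (fun j => ?_) k
    · simp only [Fin.cons_zero, pgParam_inr, pMulParam_last]
    · simp only [Fin.cons_succ, pgParam_inl_castSucc]
  rw [hcoord]
  exact hi

end Density

end Summit.Schanuel.Schanuel.Theorems

end
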